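import Summits.CriticalPhenomena.PercolationContinuityZ3.Theorems.Transplant.PlanarSkeletonFrmOfBaseOne
import Summits.CriticalPhenomena.PercolationContinuityZ3.Theorems.Transplant.PlanarSkeletonFrmCylHolds
import HarnessLib

/-!
# THE INPUT SENTENCE OF RECORD (gen 14), UNBUNDLED: `θ_v(p_c) = 0` everywhere from a chart, transitive translating frames, and — at ONE vertex —
# four unit steps, a connected unit cylinder and one chart-reversing automorphism

builds on p205010 (kernel theorem, internal audit signed; external expert review pending): the unconditional theorem runs through the CLOSED `{±1}`
node `samePDropOfSkeletonNeg₁_holds` (near-one gluing builds on p205010).  The frames-only version is modulo the OPEN node `SamePDropOfSkeletonFrm₁`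
(hypothesis; nothing is claimed about it).
Lane `prim-bschramm`, seat `prim-bschramm-p4` gen 14 (PART C3 of `P4-GENERAL.md`, §36.6–36.7).  Helper file (`--supports stmt-CriticalPhenomena-4575 --as helper`).

Stated WITHOUT any structure, so that the hypotheses can be read off the statement:
* **`theta_criticalProb_eq_zero_of_base_vertex`** (UNCONDITIONAL): `G` locally finite; `φ : V → ℤ²` 1-Lipschitz along edges; a vertex `t` such that
  every vertex is `α t` for an automorphism `α` with `φ ∘ α = φ + (φ(α t) − φ t)`; the four unit steps at `t`; the unit cylinder
  `G[{‖φ − φ t‖_∞ ≤ 1}]` connected; an automorphism fixing `t` with `φ ∘ α − φ t = −(φ − φ t)`.  THEN `θ_v(p_c) = 0` at every vertex `v`.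
  (Assembled from `PlanarSkeletonNeg.BaseData₁.toNeg` — files VIII/X: degree bound, steps and cylinders everywhere — and
  `PlanarSkeletonNeg.criticalContinuity_of_oneType` — file VI: Φ2 by file V, the rest by the node N1.)
* `theta_criticalProb_eq_zero_of_base_vertex_of_frmNode₁`: the same without the reversing automorphism, modulo N2.
[cite: BenjaminiSchramm1996, Conj. 4] [cite: KozmaNitzan2024, §1 p. 2 (approach 1); §4 pp. 15–16] [cite: AizenmanGrimmett1991, Thm 1]
-/

noncomputable section

namespace Summit.CriticalPhenomena.PercolationContinuityZ3.Theorems.Transplant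

open SimpleGraph Literature.Probability.LatticeModels Literature.Probability.Percolation
open scoped Classical

variable {V : Type} {G : SimpleGraph V} [G.LocallyFinite]

/-- **THEOREM (unconditional; the input sentence of record for the one-type `{±1}` class, unbundled).**
builds on p205010 (kernel theorem, internal audit signed; external expert review pending). [cite: BenjaminiSchramm1996, Conj. 4]
[cite: KozmaNitzan2024, §1 p. 2 (approach 1)] [cite: AizenmanGrimmett1991, Thm 1 (essential enhancements)] -/
theorem theta_criticalProb_eq_zero_of_base_vertex (φ : V → Site 2)
    (lip : ∀ ⦃u v : V⦄, G.Adj u v → ∀ i : Fin 2, |φ u i - φ v i| ≤ 1) (t : V)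
    (frame : ∀ v : V, ∃ α : G ≃g G, α t = v ∧ ∀ w, φ (α w) = φ w + (φ v - φ t))
    (step : ∀ (i : Fin 2) (σ : ℤˣ), ∃ t' : V, G.Adj t t' ∧ φ t' = φ t + Pi.single i (σ : ℤ))
    (cyl₁ : (G.induce {w | φ w - φ t ∈ box 2 1}).Connected)
    (neg : ∃ α : G ≃g G, α t = t ∧ ∀ w, φ (α w) - φ t = -(φ w - φ t)) (v : V) :
    theta G v (criticalProbIOf G v) = 0 :=
  let B : PlanarSkeletonNeg.BaseData₁ G :=
    { φ := φ, lip := lip, types := {t},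
      frame := fun v => ⟨t, Finset.mem_singleton_self t, frame v⟩,
      step_base := fun t' ht' i σ => by rw [Finset.mem_singleton] at ht'; subst ht'; exact step i σ,
      cyl1_connected := fun t' ht' => by rw [Finset.mem_singleton] at ht'; subst ht'; exact cyl₁,
      neg := fun t' ht' => by rw [Finset.mem_singleton] at ht'; subst ht'; exact neg }
  B.toNeg.criticalContinuity_of_oneType (t := t) rfl v

/-- **The frames-only version, modulo N2** (`SamePDropOfSkeletonFrm₁`, OPEN): the same data WITHOUT any point symmetry give `θ_v(p_c) = 0` at every
vertex. [cite: BenjaminiSchramm1996, Conj. 4] -/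
theorem theta_criticalProb_eq_zero_of_base_vertex_of_frmNode₁ (hD : SamePDropOfSkeletonFrm₁) (φ : V → Site 2)
    (lip : ∀ ⦃u v : V⦄, G.Adj u v → ∀ i : Fin 2, |φ u i - φ v i| ≤ 1) (t : V)
    (frame : ∀ v : V, ∃ α : G ≃g G, α t = v ∧ ∀ w, φ (α w) = φ w + (φ v - φ t))
    (step : ∀ (i : Fin 2) (σ : ℤˣ), ∃ t' : V, G.Adj t t' ∧ φ t' = φ t + Pi.single i (σ : ℤ))
    (cyl₁ : (G.induce {w | φ w - φ t ∈ box 2 1}).Connected) (v : V) :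
    theta G v (criticalProbIOf G v) = 0 :=
  let B : PlanarSkeletonFrm.BaseData₁ G :=
    { φ := φ, lip := lip, types := {t},
      frame := fun v => ⟨t, Finset.mem_singleton_self t, frame v⟩,
      step_base := fun t' ht' i σ => by rw [Finset.mem_singleton] at ht'; subst ht'; exact step i σ,
      cyl1_connected := fun t' ht' => by rw [Finset.mem_singleton] at ht'; subst ht'; exact cyl₁ }
  PlanarSkeletonFrm.criticalContinuity_of_frmNode₁ hD G B.toFrm (t := t) rfl v

end Summit.CriticalPhenomena.PercolationContinuityZ3.Theorems.Transplant

end
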